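import Summits.ResolutionOfSingularities.ResolutionOfSingularities.Theses.PAlteration
import Summits.ResolutionOfSingularities.ResolutionOfSingularities.Theses.Valuative
import Summits.ResolutionOfSingularities.ResolutionOfSingularities.Theses.FoliationDescent
import Summits.ResolutionOfSingularities.ResolutionOfSingularities.Theses.WildQuotient
import Summits.ResolutionOfSingularities.ResolutionOfSingularities.Theses.WeightedInvariant
import Summits.ResolutionOfSingularities.ResolutionOfSingularities.Theorems.WeightedInvariantDatumToResolution
import Summits.ResolutionOfSingularities.ResolutionOfSingularities.Theorems.WeightedInvariantWeightedThesisGlue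
import Summits.ResolutionOfSingularities.ResolutionOfSingularities.Theorems.PAlterationPalterationThesisGlue
import Summits.ResolutionOfSingularities.ResolutionOfSingularities.Theorems.ValuativeTorsorToLurelOfTemkin
import Literature.AlgebraicGeometry.Resolution.AlterationsPurelyInseparable
import HarnessLib

/-!
# Crux `Pialt` (stmt-ResolutionOfSingularities-0555): the crux map — what implies `Pialt`, by name

Route `ResolutionOfSingularities/pAlteration`, crux
`Summit.ResolutionOfSingularities.ResolutionOfSingularities.Theses.PAlteration.Pialt` (line lead
c2). Companion of `Theorems/PAlterationPialtSplitGlue.lean` (this line's own split: `Pialt` from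
`Temkin2013`, RRLU1 over perfect fields and patching over perfect fields) and of
`Theorems/PAlterationPicoverCruxMap.lean` (the same map for the sibling crux `Picover`). This file
records, BY NAME and sorry-free, every formal implication INTO the crux from the OTHER routes of
the summit that the tree currently supports, so that planners re-lining or re-ranking `Pialt` see
its exact position:

* `pialt_of_valuative` — **Valuative's three cruxes ⟹ `Pialt`**:
  `LuAlphaPTorsor (stmt-0641) → TorsorToLurel (stmt-10968) → PatchingRel (stmt-0642) → Pialt`
  (through the summit, `Valuative.closes`); and since `TorsorToLurel` is landed modulo Temkin's
  theorem (`torsorToLurel_of_temkin2013Relative`, `torsorToLurel_of_smoothFibre`):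
  `pialt_of_temkin2013Relative_luAlphaPTorsor_patchingRel` and
  `pialt_of_smoothFibre_luAlphaPTorsor_patchingRel` — **modulo the single Literature leaf
  `Temkin2013RelativeCurveSmoothFibre`, `Pialt ⇐ LuAlphaPTorsor ∧ PatchingRel`**, two EXISTING
  crux items (the bottom-up height-one slicing of local uniformization, dual to this line's
  top-down `stub_rrLU1Perfect`).
* `pialt_of_wildQuotientResolution_galoisQuotientAlteration` — **the resolution-FREE
  decomposition** (de Jong–Gabber): route `WildQuotient`'s cruxes `WildQuotientResolution` and
  `GaloisQuotientAlteration` give `Pialt` DIRECTLY (over the perfect closure: a purely inseparable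
  alteration by a Zariski-locally-`S^G` scheme, resolved, composed; then `stub_pialtOfPerfect`),
  WITHOUT `Picover` and without proving the summit — extracted verbatim from the inner block of
  `WildQuotient.closes`.
* `pialt_of_foliationDescent`, `pialt_of_weightedInvariant` — the deciding hypotheses of routes
  `FoliationDescent` and `WeightedInvariant` give `Pialt` (through the summit).

All proofs are compositions of landed theorems and the routes' deciding theorems `closes`; no
new definitions. Sources: A. J. de Jong, Publ. IHÉS 83 (1996) and Ann. Inst. Fourier 47 (1997);
M. Temkin, J. Algebra 373 (2013), Thm. 1.3.2; O. Piltant, RACSAM 107 (2013), Prop. 5.1.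
-/

set_option linter.dupNamespace false -- mandated namespace of this single-conjunct summit

noncomputable section

open CategoryTheory AlgebraicGeometry
open Literature.AlgebraicGeometry.Resolution
open Summit.ResolutionOfSingularities.ResolutionOfSingularities

namespace Summit.ResolutionOfSingularities.ResolutionOfSingularities.Theorems.Pialt.CruxMap

/-! ## From route `Valuative` -/

/-- **Valuative's three cruxes ⟹ `Pialt`**: `LuAlphaPTorsor → TorsorToLurel → PatchingRel →
Pialt`, through the summit (`Valuative.closes`) and `pialt_of_resolutionOfSingularities`.
[folklore] -/
theorem pialt_of_valuative : Summit.ResolutionOfSingularities.ResolutionOfSingularities.Theses.Valuative.LuAlphaPTorsor → Summit.ResolutionOfSingularities.ResolutionOfSingularities.Theses.Valuative.TorsorToLurel → Summit.ResolutionOfSingularities.ResolutionOfSingularities.Theses.Valuative.PatchingRel → Summit.ResolutionOfSingularities.ResolutionOfSingularities.Theses.PAlteration.Pialt :=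
  fun h₂ h₄ h₃ => Theorems.pialt_of_resolutionOfSingularities (Theses.Valuative.closes h₂ h₄ h₃)

/-- **`Pialt` from `LuAlphaPTorsor` (stmt-0641) and `PatchingRel` (stmt-0642), modulo Temkin's
inseparable local uniformization** (named fact `Temkin2013Relative`, Temkin 2013 Thm. 1.3.2 in
its relative form): `TorsorToLurel` is landed modulo it (`torsorToLurel_of_temkin2013Relative`).
[cite: Temkin2013, Thm. 1.3.2] -/
theorem pialt_of_temkin2013Relative_luAlphaPTorsor_patchingRel (hT : Temkin2013Relative.{0}) :
    Theses.Valuative.LuAlphaPTorsor → Theses.Valuative.PatchingRel → Theses.PAlteration.Pialt :=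
  fun h₂ h₃ => pialt_of_valuative h₂ (Theorems.torsorToLurel_of_temkin2013Relative hT) h₃

/-- **`Pialt` from `LuAlphaPTorsor` and `PatchingRel`, modulo the single remaining Literature
leaf `Temkin2013RelativeCurveSmoothFibre`** (Temkin 2013, Thm. 3.3.1 for `k`-smooth generic
fibres; the rest of the proof cone of Temkin's theorem is in tree).
[cite: Temkin2013, Thm. 3.3.1 and Thm. 1.3.2] -/
theorem pialt_of_smoothFibre_luAlphaPTorsor_patchingRel (hsf : Temkin2013RelativeCurveSmoothFibre.{0}) : Summit.ResolutionOfSingularities.ResolutionOfSingularities.Theses.Valuative.LuAlphaPTorsor → Summit.ResolutionOfSingularities.ResolutionOfSingularities.Theses.Valuative.PatchingRel → Summit.ResolutionOfSingularities.ResolutionOfSingularities.Theses.PAlteration.Pialt :=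
  fun h₂ h₃ => pialt_of_valuative h₂ (Theorems.torsorToLurel_of_smoothFibre hsf) h₃

/-- The whole `ValuativeThesis` (absolute local uniformization and absolute patching in every
prime characteristic) gives `Pialt`. [folklore] -/
theorem pialt_of_valuativeThesis (h : Theses.Valuative.ValuativeThesis) :
    Theses.PAlteration.Pialt :=
  Theorems.pialt_of_resolutionOfSingularities fun p hp => (h p hp).2 (h p hp).1

/-! ## From route `WildQuotient`: the resolution-free decomposition (de Jong–Gabber) -/

/-- **`Pialt` from `WildQuotientResolution` and `GaloisQuotientAlteration` alone** — no
`Picover`, no summit: over the perfect closure `K = k^{p^{-∞}}`, de Jong's Galois alteration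
(crux `GaloisQuotientAlteration`) gives a purely inseparable alteration `ψ : Y → X` by a scheme
`Y` that is Zariski-locally a quotient `S / G` of a regular scheme by a finite group; the crux
`WildQuotientResolution` resolves `Y`; a resolution followed by `ψ` is a purely inseparable
REGULAR alteration (`IsPurelyInseparableAlteration.comp`); imperfect `k` by
`stub_pialtOfPerfect`. Extracted from the inner block of `WildQuotient.closes`.
[cite: DeJong1997, Thm. 7.3; Temkin2013, §1 p. 3 (i), (iii)] -/
theorem pialt_of_wildQuotientResolution_galoisQuotientAlteration (hW : Summit.ResolutionOfSingularities.ResolutionOfSingularities.Theses.WildQuotient.WildQuotientResolution) (hG : Summit.ResolutionOfSingularities.ResolutionOfSingularities.Theses.WildQuotient.GaloisQuotientAlteration) : Summit.ResolutionOfSingularities.ResolutionOfSingularities.Theses.PAlteration.Pialt := by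
  intro p hp k _ _ X₀ f₀ hs₀ hl₀ hq₀ hi₀
  haveI : Fact p.Prime := ⟨hp⟩
  haveI := hs₀
  haveI := hl₀
  haveI := hq₀
  haveI := hi₀
  refine Theorems.PalterationThesis.PerfectTransfer.stub_pialtOfPerfect p k ?_ X₀ f₀
  intro X f hs hl hq hi
  obtain ⟨Y, ψ, ⟨hψ, hY, hsurj, hU⟩, hloc⟩ := hG p hp (PerfectClosure k p) X f hs hl hq hi
  haveI := hψ
  haveI := hY
  haveI := hi
  have hres : Scheme.HasResolution Y :=
    hW p hp (PerfectClosure k p) Y (ψ ≫ f) inferInstance inferInstance inferInstance hY hloc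
  haveI : Surjective ψ := ⟨hsurj⟩
  have hψ' : IsPurelyInseparableAlteration ψ := by
    obtain ⟨U, hUd, hfin, hui⟩ := hU
    exact ⟨hY, hψ, inferInstance, U, hUd.nonempty, hfin, hui⟩
  obtain ⟨Y', π, hπ, hreg⟩ := hres.exists_isPurelyInseparableAlteration_and_isRegular
  have hc := hπ.comp hψ'
  obtain ⟨U', hU', hfin', hui'⟩ := hc.exists_dense
  exact ⟨Y', π ≫ ψ, hc.isProper, hc.isIntegral, hreg, hc.surjective.1, U', hU', hfin', hui'⟩

/-! ## From routes `FoliationDescent` and `WeightedInvariant` (through the summit) -/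

/-- Route `FoliationDescent`'s six deciding hypotheses give `Pialt` (through its `closes`). Compare
`Pialt.RadiciallyRegular.pialt_of_temkin2013_folLU_logCanQuotLU_patchingPerfect`
(`Theorems/PAlterationPialtSplitGlue.lean`): modulo `Temkin2013`, the two cruxes `FolLU`,
`LogCanQuotLU` and ABSOLUTE patching over perfect fields already suffice — `DualSandwich`,
`TorsorToLurelPerfect` and `DescentPerfectToAll` are not needed for `Pialt`. [folklore] -/
theorem pialt_of_foliationDescent (hF : Theses.FoliationDescent.FolLU)
    (hQ : Theses.FoliationDescent.LogCanQuotLU) (hR : Theses.FoliationDescent.DualSandwich)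
    (hT : Theses.FoliationDescent.TorsorToLurelPerfect)
    (hP : Theses.FoliationDescent.PatchingRelPerfect)
    (hD : Theses.FoliationDescent.DescentPerfectToAll) : Theses.PAlteration.Pialt :=
  Theorems.pialt_of_resolutionOfSingularities (Theses.FoliationDescent.closes hF hQ hR hT hP hD)

/-- Route `WeightedInvariant`'s three deciding hypotheses give `Pialt` (through its `closes`).
[folklore] -/
theorem pialt_of_weightedInvariant (hC : Theses.WeightedInvariant.WeightedConstruction)
    (hE : Theses.WeightedInvariant.DatumToEmbedded)
    (hD : Theses.WeightedInvariant.DescentPerfectToAll) : Theses.PAlteration.Pialt :=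
  -- buildfix (bf3-g25, 2026-08-27): route WeightedInvariant rev 21 (02:44Z) re-typed `closes` to the hypersurface door
  -- (HypersurfaceCentreConstruction / HypersurfaceCentreToResolution); the summit from THIS theorem's three hypotheses is
  -- the landed tail `WeightedThesis.Glue.resolutionOfSingularities_of_items` with `DatumToResolution` derived from
  -- `DatumToEmbedded` (`datumToResolution_of_datumToEmbedded`); statement unchanged.
  Theorems.pialt_of_resolutionOfSingularities
    (Theorems.WeightedThesis.Glue.resolutionOfSingularities_of_items hC
      (Theorems.datumToResolution_of_datumToEmbedded hE) hD)

end Summit.ResolutionOfSingularities.ResolutionOfSingularities.Theorems.Pialt.CruxMap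

end
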